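import Summits.QuantumFields.YangMills.Theorems.UnitScaleTiltProp7SectET3N06LeavesRecordCutKept
import Summits.QuantumFields.YangMills.Theorems.UnitScaleTiltProp7SectET3N06LeavesRecordCutFam
import HarnessLib

/-!
# Route `UnitScaleTilt` (α), node N06(d = 3) — **THE KEPT-FIELD SECOND CUT OF THE T³ LEAF OF RECORD ALONG AN ARBITRARY SUB-FAMILY `π : J → KIdx 2 ℓ hd3 hL b₀ b₁`**:
# ym-inputs-p04 g4's `Prop7SectET3N06LeavesRecordCutKept.t313_of_pins_T3_completePairMBZk` (the block-L² storey displayed as dag-n06-d's kept sub-record `Letters313L2Pk` + the printed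
# lines Thm 3.1 (3.42) for G′, (3.49), (3.46)₄, `R = ϱ(I − P)`, three transposes — the cut artefacts `vDRDG ∕ vGDRD` DERIVED) with every row read over `x : J` at `geo9K (π x)` ∕
# `bgT3 (π x)` — the sub-family reading of the kept cut, for the record re-cut over `{i // 1 ≤ i.m}`

Cell `ym-inputs` (D-0154 (2); desk `ym-inputs-plan-1` INPUT-LIST §4 rows p04∕p05, WORD 5 2026-08-28T13:50:20Z (p04 g4 MINE 1 ✓ `…CutKept`; «MINE 2 [the S-layer kept twin] waits for
the `{i ∕∕ 1 ≤ i.m}` record re-cut»); HANDOFF §§ ym-inputs-p05 g2∕g3∕g4 item (2)), seat ym-inputs-p05 g5.  Count-neutral helper (`--supports stmt-QuantumFields-20520 --as helper`);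
registry untouched; THEOREMS ONLY (0 `def`, 0 `sorry`); NOTHING of [Balaban1985BackgroundPropagators] is asserted.

WHAT.  ★★★ `t313_of_pins_completePairMBZk_fam π` — the statement of `t313_of_pins_T3_completePairMBZk` with EXACTLY these changes: every binder `i : KIdx 2 ℓ hd3 hL b₀ b₁` becomes
`i : J`, every `geo9K i` ∕ `bgT3 i` ∕ `RelB i` ∕ `geoOK_geo9K i` becomes `geo9K (π i)` ∕ `bgT3 (π i)` ∕ `RelB (π i)` ∕ `geoOK_geo9K (π i)` (carriers `X Y Z W PX PY : J → Type`, side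
predicate `H₀ : J → Prop`), and the conclusion is `B9.Thm313Printed c35 (fun i ↦ geo9K (π i)) (fun i ↦ bgT3 (π i)) GG HasRWExp PosDefK`; instance binders stay the whole family's.
PROOF: p04 g4's VERBATIM — thresholds from the sub-family rows `Prop7SectET3GeometryFam.lemma21Pack_geo9K_fam ∕ rowSum261_geo9K_fam`, the block-L² record re-assembled by
`Letters313L2Pc.of_kept` + `vDRDG_of_ids3152 ∕ vGDRD_of_ids3152` member by member, then the sub-family parent leaf `Prop7SectET3N06LeavesRecordCutFam.t313_of_pins_completePairMBZc_fam π`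
BY NAME.  The original is the `π := id` reading (untouched, additive); the record instantiation uses `π := (·.1)` on `{i : KIdx 2 ℓ hd3 hL 1 1 // 1 ≤ i.m}`.
L-FLOOR: none beyond the parent's.  HONEST SCOPE: a re-indexing of a by-name port; every analytic row stays a displayed HYPOTHESIS about the genuine operators; N06(d = 3) NOT
discharged; nothing here claims EX, the crux, V3∕R3, d = 4 or the mass gap; YM₃ on T³ = ladder rung R3 (RECORD), not the Clay problem.

References: T. Bałaban, CMP **99** (1985) 389–434 [Balaban1985BackgroundPropagators] (Thm 3.13 p.426, (3.152)–(3.153) pp.425–426, Thm 3.1 (3.42)–(3.46) pp.397–398, (3.49) p.399, p.391);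
CMP **96** (1984) 223–250 [Balaban1984PropagatorsII] (Lemma 2.1 (2.59)–(2.61) pp.233–234, (2.51)–(2.56) pp.232–233).
-/

set_option autoImplicit false

noncomputable section

open scoped Matrix.Norms.L2Operator

namespace Summit.QuantumFields.YangMills.Theorems.Prop7SectET3N06LeavesRecordCutKeptFam


open Literature.MathematicalPhysics.QuantumFieldTheory.Balaban1983to89
open Finset B6RandomWalk B6RandomWalkHom B9Thm34Ext B9Thm37GlueCor36 B11SectG B9SectDSup B9Thm37AllNorms
open B9Thm37AllNormsInstances B9FromB6 B9FromB6ModelSignsOn B9SectBStepWhole B9Thm312Whole B9Thm312WholeLeaf B9Thm312WholeLeft B9Thm313Whole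
open B9Thm313WholeLeft B9Thm312WholeLeafLeftGlob B9Ineq347CoReading B9SectCDiffDict B9CoRealizesRel B9Thm37Glue B9SectDL2Decay B9RWSums343Holder
open B9RWSumsReadsRel B9RWSumsReadsNbr B9Ineq347 B9Thm312WholeClasses B9Thm312WholeL2 B9Thm312WholeBlocksRel B9Thm312WholeBlocksNbr B9Thm313WholeLeafRel
open B9Thm312WholeHolder B9Thm312WholeHHolder B9Thm313WholeHolder B9Thm313WholeL2G B9Thm313WholeL2GP B9Thm313WholeInput B9Thm313WholeBlocksNbr B9Thm312WholeLeafAll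
open B9RWSums346SecondDiff B9Thm313WholeBlocksNbrRec B9RWSums344InputFam B9Thm312WholeDir B9Thm312WholeBlocksPairM B9Thm313WholeDir B9Thm313WholeDirInput B9Thm313WholeBlocksPairM
open B9Thm313WholeLeafCompletePairM B9Thm312WholeDirB B9Thm313WholeDirInputB B9Thm313WholeBlocksPairMB B9Thm313WholeLeafCompletePairMB B9Thm313WholeBlocksPairMZ B9Thm313WholeBlocksPairMBZ B9Thm313WholeLeafRelZ
open B9Thm312WholeHZ B9Thm313WholeZ B9Thm313WholeLeftZ B9Thm313WholeHolderZ B9Thm313WholeInputZ B9Thm313WholeDirZ B9Thm313WholeDirInputZ B9Thm313WholeDirInputBZ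
open B9Thm313WholeL2GZ B9Thm313WholeL2GPZ B9Thm313WholeDirL2Z B9Thm313WholeLeafCompletePairMBZ
open B9PerturbationMajorantAlgebra (Thm31GpMaj Proj349Maj)
open B9RWSums343to347Whole (Facts347)
open B9Thm313WholeRgdFrom3152 (Ids3152)
open B9Thm313WholeLettersCut (Letters313Zc Letters313HZc Letters313L2Pc)
open B9Thm313WholeLettersCutKept (Letters313L2Pk)
open B9Thm313WholeCutLettersL2From3152 (vDRDG_of_ids3152 vGDRD_of_ids3152)
open B6KLevelCensusIndexV1 (KIdx)
open B9GeoNormsKLevelV1 (geo9K)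
open B9CoRealizesRelAtLetters (RelB)
open Summit.QuantumFields.YangMills.Theorems.Prop7SectET3Members (hd3)
open Summit.QuantumFields.YangMills.Theorems.Prop7SectET3Geometry (geoOK_geo9K)
open Summit.QuantumFields.YangMills.Theorems.Prop7SectET3BgClass (bgT3)
open Summit.QuantumFields.YangMills.Theorems.Prop7SectET3N06LeavesRecordCutFam (t313_of_pins_completePairMBZc_fam)
open Summit.QuantumFields.YangMills.Theorems.Prop7SectET3GeometryFam (lemma21Pack_geo9K_fam rowSum261_geo9K_fam)


variable {ℓ : ℕ} {hL : Odd (ℓ + 1) ∧ 1 < ℓ + 1} {b₀ b₁ : ℝ} {c35 : ℝ} {J : Type} (π : J → KIdx 2 ℓ hd3 hL b₀ b₁)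

/-- the direction-indexed block-L² letters `Letters313L2MZ` at a LARGER constant (`B₄ ≤ B₄'`; the weights `v_Z(y′)·L^{j′}η` are nonnegative) — the constant twin of
`B9Thm313WholeDirL2Z.letters313L2MZ_mono` (which moves the rate); private bookkeeping for meeting the derived letters' constant. [cite: Balaban1985BackgroundPropagators, (3.46) p.398 (bookkeeping)] -/
private theorem letters313L2MZ_mono_const {g : B9.Geometry} {B : B9.Backgrounds} {X Y Z W P : Type} [Fintype X] [Fintype Z] [Fintype W] [Fintype g.Site]
    {R₀ : ℝ} {H₀ : Prop} {𝔬 : Ops g B X Y Z W} {Dd Dds : B.Cfg → P → Module.End ℝ (X → ℝ)} {B₄ B₄' δ : ℝ} {U : B.Cfg}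
    (hG : GeoOK g) (hBB : B₄ ≤ B₄') {vZ : g.Site → ℝ} {hvZ : ∀ y, 0 < vZ y} (h : Letters313L2MZ 𝔬 Dd Dds R₀ H₀ B₄ δ vZ hvZ U) :
    Letters313L2MZ 𝔬 Dd Dds R₀ H₀ B₄' δ vZ hvZ U := by
  have hE : ∀ y y' : g.Site, 0 ≤ Real.exp (-(δ * g.dist y y')) := fun _ _ => Real.exp_nonneg _
  have hv : ∀ y : g.Site, 0 ≤ vZ y * g.len y := fun y => mul_nonneg (hvZ y).le (hG.lenle y)
  exact
    { dGDvd := fun ν => (h.dGDvd ν).mono fun y y' => mul_le_mul_of_nonneg_right hBB (hE y y')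
      dGQsd := fun ν => (h.dGQsd ν).mono fun y y' => mul_le_mul_of_nonneg_right (mul_le_mul_of_nonneg_right hBB (hv y')) (hE y y')
      rgdDd := fun μ => (h.rgdDd μ).mono fun y y' => mul_le_mul_of_nonneg_right hBB (hE y y') }

/-- ★★★ **THEOREM 3.13 AS THE WHOLE PRINTED LEAF, RE-CUT TO PRINT'S LETTER SPECIES, THE BLOCK-L² STOREY DISPLAYED AS THE KEPT SUB-RECORD + PRINTED LINES, READ ALONG A
SUB-FAMILY `π : J → KIdx 2 ℓ hd3 hL b₀ b₁`** (statement of `Prop7SectET3N06LeavesRecordCutKept.t313_of_pins_T3_completePairMBZk` with `i : J`, `geo9K (π i)`, `bgT3 (π i)`, `RelB (π i)`,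
`geoOK_geo9K (π i)` throughout — see there for every binder: `hLL2` valued in `Letters313L2Pk … ∧ Letters313L2MZ …`, the site-projection letter `Pp` (print's `P`), the constants
`ϱ CP BD BG δG` with `δ₃ < δG`, the rows `h31` (Thm 3.1 (3.42) for G′), `h49` ((3.49)), `hDGD` ((3.46)₄ for G′), `hRP` (`R = ϱ(I − P)`), `hT` (three transposes); (3.152) is the displayed
`h152`).  DISCHARGED INSIDE (at `π j`): the member facts and the row sum above a threshold (`lemma21Pack_geo9K_fam`, `rowSum261_geo9K_fam`), the constant∕threshold bookkeeping, the two
derived letters; then `t313_of_pins_completePairMBZc_fam π` BY NAME.  Conclusion: `B9.Thm313Printed c35 (fun i ↦ geo9K (π i)) (fun i ↦ bgT3 (π i)) GG HasRWExp PosDefK`.  Nothing of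
print asserted; NOT a discharge of N06(d = 3).
[cite: Balaban1985BackgroundPropagators, Thm 3.13 p.426, (3.152)-(3.153) pp.425-426, Thm 3.1 (3.42)-(3.46) pp.397-398, (3.49) p.399, p.391; Balaban1984PropagatorsII, Lemma 2.1 (2.59)-(2.61) pp.233-234, (2.51)-(2.56) pp.232-233] -/
theorem t313_of_pins_completePairMBZk_fam [∀ i : KIdx 2 ℓ hd3 hL b₀ b₁, Fintype (geo9K i).Site] [∀ i : KIdx 2 ℓ hd3 hL b₀ b₁, DecidableEq (geo9K i).Site]
    {X Y Z W PX PY : J → Type} {P : Type} [∀ i, Fintype (X i)] [∀ i, DecidableEq (X i)] [∀ i, Fintype (Y i)]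
    [∀ i, Fintype (Z i)] [∀ i, Fintype (W i)] [∀ i, Fintype (PX i)] [∀ i, Fintype (PY i)] [Fintype P]
    (𝔬 : ∀ i : J, Ops (geo9K (π i)) (bgT3 (π i)) (X i) (Y i) (Z i) (W i)) (H₀ : J → Prop)
    (GG : ∀ i : J, B9.KernelFamily (geo9K (π i)) (bgT3 (π i))) (bH : ∀ i : J, BlockNorm (toB6 (geo9K (π i)) 1 (H₀ i)) (W i → ℝ))
    (𝔭 : ∀ i : J, HolderProbes (geo9K (π i)) (bgT3 (π i)) (X i) (Y i) (PX i) (PY i))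
    (bHX : ∀ i : J, ℝ → BlockNorm (toB6 (geo9K (π i)) 1 (H₀ i)) (X i → ℝ))
    (Gp : ∀ i : J, (bgT3 (π i)).Cfg → Module.End ℝ (W i → ℝ))
    (bXH : ∀ i : J, BlockNorm (toB6 (geo9K (π i)) 1 (H₀ i)) (X i → ℝ))
    (Pp : ∀ i : J, (bgT3 (π i)).Cfg → Module.End ℝ (W i → ℝ))
    (Dd Dds : ∀ i : J, (bgT3 (π i)).Cfg → P → Module.End ℝ (X i → ℝ))
    (bHW : ∀ i : J, ℝ → BlockNorm (toB6 (geo9K (π i)) 1 (H₀ i)) (W i → ℝ))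
    (ev : ∀ i : J, (geo9K (π i)).Loc → X i → ℝ) (evY : ∀ i : J, (geo9K (π i)).Loc → Y i → ℝ)
    (r Cev θ₁ θD θ₂ r₁ B₀ B₂ B₄ δ₀ δK σ ρ a₁ M₁ B₃ δ₃ ρ' α κ₀ : ℝ) (ϱ CP BD BG δG : ℝ) (Bh Bi Bq BhD Bx Bd θH θI θV Br : ℝ → ℝ)
    (Bi2 Bd2 : ℝ → ℝ → ℝ)
    (hθ₁ : 0 ≤ θ₁) (hθD : 0 ≤ θD) (hθH : ∀ β, 0 ≤ β → β < 1 → 0 ≤ θH β) (hθI : ∀ ε, 0 < ε → 0 ≤ θI ε) (hθ₂ : 0 ≤ θ₂)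
    (hθV : ∀ ε, 0 < ε → 0 ≤ θV ε) (hr₁ : 0 ≤ r₁) (hB₀ : 0 ≤ B₀) (hB₂ : 0 ≤ B₂)
    (hB₃ : 0 ≤ B₃) (hB₄ : 0 ≤ B₄) (hBr : ∀ ε, 0 < ε → 0 ≤ Br ε) (hσ : 0 < σ) (hρ' : 0 < ρ') (hρ'ρ : ρ' + 3 * σ ≤ ρ) (hρ'ρ₅ : ρ' + 5 * σ ≤ ρ)
    (hσρ' : 3 * σ < (1 - α) * ρ')
    (hρS : ρ ≤ δ₀) (hρ₃ : ρ ≤ δ₃) (hρδ : ρ + σ ≤ δK) (ha₁ : 0 < a₁) (hM₁ : 0 < M₁)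
    (hα0 : 0 < α) (hα1 : α < 1) (hBi : ∀ ε, 0 < ε → ε ≤ 1 → 0 ≤ Bi ε) (hBd : ∀ ε, 0 < ε → ε ≤ 1 → 0 ≤ Bd ε)
    (hBi2 : ∀ ε β, 0 < ε → ε ≤ 1 → 0 ≤ β → β < 1 → 0 ≤ Bi2 ε β) (hBd2 : ∀ ε β, 0 < ε → ε ≤ 1 → 0 ≤ β → β < 1 → 0 ≤ Bd2 ε β)
    (hBh : ∀ β, 0 ≤ β → β < 1 → 0 ≤ Bh β) (hBq : ∀ β, 0 ≤ β → β < 1 → 0 ≤ Bq β) (hBhD : ∀ β, 0 ≤ β → β < 1 → 0 ≤ BhD β)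
    (hBx : ∀ β, 0 ≤ β → β < 1 → 0 ≤ Bx β) (hCev : 0 ≤ Cev)
    (hϱ : 0 ≤ ϱ) (hCP : 0 ≤ CP) (hBD : 0 ≤ BD) (hBG : 0 ≤ BG) (hδ₃G : δ₃ < δG)
    (hκ : ∀ i : J, (bH i).κ ≤ κ₀)
    (hκW : ∀ (i : J) (ε : ℝ), (bHW i ε).κ ≤ κ₀)
    (hκX : ∀ i : J, (bXH i).κ ≤ κ₀)
    (hcoR : ∀ (i : J) (U : (bgT3 (π i)).Cfg),
      CoRealizesRel (GG i) 0 U (RelB (π i)) (𝔬 i).blk (𝔬 i).blk (ev i) ((𝔬 i).GG U) ∧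
      CoRealizesRel (GG i) 2 U (RelB (π i)) (𝔬 i).blk (𝔬 i).blkY (evY i) ((𝔬 i).GG U ∘ₗ (𝔬 i).Dstar U))
    (hco1R : ∀ (i : J) (U : (bgT3 (π i)).Cfg), CoRealizesRel (GG i) 1 U (RelB (π i)) (𝔬 i).blkY (𝔬 i).blk (ev i) ((𝔬 i).D U ∘ₗ (𝔬 i).GG U))
    (hcoG : ∀ (i : J) (U : (bgT3 (π i)).Cfg),
      CoReadsGlob (GG i) 0 U (𝔬 i).blk (𝔬 i).blk (ev i) ((𝔬 i).GG U) ∧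
      CoReadsGlob (GG i) 1 U (𝔬 i).blkY (𝔬 i).blk (ev i) ((𝔬 i).D U ∘ₗ (𝔬 i).GG U) ∧
      CoReadsGlob (GG i) 2 U (𝔬 i).blk (𝔬 i).blkY (evY i) ((𝔬 i).GG U ∘ₗ (𝔬 i).Dstar U))
    (hsymGG : ∀ i : J, M₁ ≤ (geo9K (π i)).M → ∀ α₀ : ℝ, 0 < α₀ → (geo9K (π i)).M * α₀ ≤ a₁ →
      ∀ U : (bgT3 (π i)).Cfg, (bgT3 (π i)).Reg335 c35 α₀ U → (bgT3 (π i)).Reg336 c35 α₀ U →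
        IsTransposePair ((𝔬 i).GG U) ((𝔬 i).GG U) ∧ IsTransposePair ((𝔬 i).D U ∘ₗ (𝔬 i).GG U) ((𝔬 i).GG U ∘ₗ (𝔬 i).Dstar U))
    (hl2N : ∀ (i : J) (U : (bgT3 (π i)).Cfg),
      L2ReadsNbr (R := (1 : ℝ)) (H := H₀ i) (GG i) 0 U (RelB (π i)) r Cev (𝔬 i).blk (𝔬 i).blk (ev i) ((𝔬 i).GG U) ∧
      L2ReadsNbr (R := (1 : ℝ)) (H := H₀ i) (GG i) 1 U (RelB (π i)) r Cev (𝔬 i).blkY (𝔬 i).blk (ev i) ((𝔬 i).D U ∘ₗ (𝔬 i).GG U) ∧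
      L2ReadsNbr (R := (1 : ℝ)) (H := H₀ i) (GG i) 2 U (RelB (π i)) r Cev (𝔬 i).blk (𝔬 i).blkY (evY i) ((𝔬 i).GG U ∘ₗ (𝔬 i).Dstar U) ∧
      L2ReadsNbr (R := (1 : ℝ)) (H := H₀ i) (GG i) 3 U (RelB (π i)) r Cev ((𝔬 i).blk ∘ Prod.fst) (𝔬 i).blk (ev i)
        (familyOp (fun q : P × P => Dd i U q.1 ∘ₗ ((𝔬 i).GG U ∘ₗ Dds i U q.2))) ∧
      L2ReadsNbr (R := (1 : ℝ)) (H := H₀ i) (GG i) 4 U (RelB (π i)) r Cev ((𝔬 i).blk ∘ Prod.fst) (𝔬 i).blk (ev i)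
        (familyOp (fun q : P × P => (Dd i U q.1 ∘ₗ Dd i U q.2) ∘ₗ (𝔬 i).GG U)) ∧
      L2ReadsNbr (R := (1 : ℝ)) (H := H₀ i) (GG i) 5 U (RelB (π i)) r Cev ((𝔬 i).blk ∘ Prod.fst) (𝔬 i).blk (ev i)
        (familyOp (fun q : P × P => (𝔬 i).GG U ∘ₗ (Dds i U q.1 ∘ₗ Dds i U q.2))))
    (hH1N : ∀ (i : J) (U : (bgT3 (π i)).Cfg),
      H1ReadsNbr (GG i) U (𝔭 i) (RelB (π i)) r (𝔬 i).blk (𝔬 i).blkY (ev i) (evY i) ((𝔬 i).D U ∘ₗ (𝔬 i).GG U)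
        ((𝔬 i).GG U ∘ₗ (𝔬 i).Dstar U))
    (hIF : ∀ (i : J) (U : (bgT3 (π i)).Cfg),
      InputReadsFam (GG i) U (bHX i) r ((𝔬 i).blk ∘ Prod.fst) ((𝔭 i).blkPX ∘ Prod.fst) (fun β => sliceProbe ((𝔭 i).ΦX U β)) (ev i)
        (familyOp (fun q : P × P => Dd i U q.1 ∘ₗ ((𝔬 i).GG U ∘ₗ Dds i U q.2))))
    (hmodel : ∀ i : J, M₁ ≤ (geo9K (π i)).M → ∀ α₀ : ℝ, 0 < α₀ → (geo9K (π i)).M * α₀ ≤ a₁ →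
      ∀ U : (bgT3 (π i)).Cfg, (bgT3 (π i)).Reg335 c35 α₀ U → (bgT3 (π i)).Reg336 c35 α₀ U →
        Thm33G0 (𝔬 i) 1 (H₀ i) B₀ δ₀ U ∧
        Step (𝔬 i) 1 (H₀ i) (geoOK_geo9K (π i)).lenle 1 (θ₁ * ((geo9K (π i)).M * α₀)) δK U ∧
        Step (𝔬 i) 1 (H₀ i) (geoOK_geo9K (π i)).lenle 2 (θ₁ * ((geo9K (π i)).M * α₀)) δK U ∧
        FormSmall (𝔬 i) (r₁ * ((geo9K (π i)).M * α₀)) U ∧ Identities (𝔬 i) U)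
    (hleft : ∀ i : J, M₁ ≤ (geo9K (π i)).M → ∀ α₀ : ℝ, 0 < α₀ → (geo9K (π i)).M * α₀ ≤ a₁ →
      ∀ U : (bgT3 (π i)).Cfg, (bgT3 (π i)).Reg335 c35 α₀ U → (bgT3 (π i)).Reg336 c35 α₀ U →
        LeftStep (𝔬 i) 1 (H₀ i) (geoOK_geo9K (π i)).lenle B₀ δ₀ (θD * ((geo9K (π i)).M * α₀)) δK U)
    (wZ : ∀ i : J, (geo9K (π i)).Site → ℝ) (hwZ : ∀ i y, 0 < wZ i y)
    (hletters : ∀ i : J, M₁ ≤ (geo9K (π i)).M → ∀ α₀ : ℝ, 0 < α₀ → (geo9K (π i)).M * α₀ ≤ a₁ →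
      ∀ U : (bgT3 (π i)).Cfg, (bgT3 (π i)).Reg335 c35 α₀ U → (bgT3 (π i)).Reg336 c35 α₀ U →
        Letters313Zc (𝔬 i) (Gp i) 1 (H₀ i) (geoOK_geo9K (π i)) (wZ i) (hwZ i) B₃ δ₃ (bXH i) U)
    (h152 : ∀ i : J, M₁ ≤ (geo9K (π i)).M → ∀ α₀ : ℝ, 0 < α₀ → (geo9K (π i)).M * α₀ ≤ a₁ →
      ∀ U : (bgT3 (π i)).Cfg, (bgT3 (π i)).Reg335 c35 α₀ U → (bgT3 (π i)).Reg336 c35 α₀ U → Ids3152 (𝔬 i) (Gp i) U)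
    -- ======== NEW: Theorem 3.1 for G′, (3.49) for P, (3.46)₄ for G′, R = ϱ(I − P), the transposes (the inputs of `vDRDG_of_ids3152 ∕ vGDRD_of_ids3152`) ========
    (h31 : ∀ i : J, M₁ ≤ (geo9K (π i)).M → ∀ α₀ : ℝ, 0 < α₀ → (geo9K (π i)).M * α₀ ≤ a₁ →
      ∀ U : (bgT3 (π i)).Cfg, (bgT3 (π i)).Reg335 c35 α₀ U → (bgT3 (π i)).Reg336 c35 α₀ U →
        Thm31GpMaj (𝔬 i).blkW (𝔬 i).blk (Gp i U) ((𝔬 i).Dv U) ((𝔬 i).Dvstar U) 1 (H₀ i) BG δG)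
    (h49 : ∀ i : J, M₁ ≤ (geo9K (π i)).M → ∀ α₀ : ℝ, 0 < α₀ → (geo9K (π i)).M * α₀ ≤ a₁ →
      ∀ U : (bgT3 (π i)).Cfg, (bgT3 (π i)).Reg335 c35 α₀ U → (bgT3 (π i)).Reg336 c35 α₀ U →
        Proj349Maj (𝔬 i).blkW (𝔬 i).blk (Pp i U) ((𝔬 i).Dv U) ((𝔬 i).Dvstar U) 1 (H₀ i) CP δG)
    (hDGD : ∀ i : J, M₁ ≤ (geo9K (π i)).M → ∀ α₀ : ℝ, 0 < α₀ → (geo9K (π i)).M * α₀ ≤ a₁ →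
      ∀ U : (bgT3 (π i)).Cfg, (bgT3 (π i)).Reg335 c35 α₀ U → (bgT3 (π i)).Reg336 c35 α₀ U →
        BlockBd (g := toB6 (geo9K (π i)) 1 (H₀ i)) (𝔬 i).blk (𝔬 i).blk ((𝔬 i).Dv U ∘ₗ Gp i U ∘ₗ (𝔬 i).Dvstar U)
          (fun (y y' : (geo9K (π i)).Site) => BD * Real.exp (-(δG * (geo9K (π i)).dist y y'))))
    (hRP : ∀ i : J, M₁ ≤ (geo9K (π i)).M → ∀ α₀ : ℝ, 0 < α₀ → (geo9K (π i)).M * α₀ ≤ a₁ →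
      ∀ U : (bgT3 (π i)).Cfg, (bgT3 (π i)).Reg335 c35 α₀ U → (bgT3 (π i)).Reg336 c35 α₀ U → (𝔬 i).R U = ϱ • (LinearMap.id - Pp i U))
    (hT : ∀ i : J, M₁ ≤ (geo9K (π i)).M → ∀ α₀ : ℝ, 0 < α₀ → (geo9K (π i)).M * α₀ ≤ a₁ →
      ∀ U : (bgT3 (π i)).Cfg, (bgT3 (π i)).Reg335 c35 α₀ U → (bgT3 (π i)).Reg336 c35 α₀ U →
        IsTransposePair (Gp i U) (Gp i U) ∧ IsTransposePair ((𝔬 i).Dv U) ((𝔬 i).Dvstar U) ∧ IsTransposePair (Pp i U) (Pp i U))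
    -- ======== the parent's remaining rows, VERBATIM ========
    (hlettersD : ∀ i : J, M₁ ≤ (geo9K (π i)).M → ∀ α₀ : ℝ, 0 < α₀ → (geo9K (π i)).M * α₀ ≤ a₁ →
      ∀ U : (bgT3 (π i)).Cfg, (bgT3 (π i)).Reg335 c35 α₀ U → (bgT3 (π i)).Reg336 c35 α₀ U →
        Letters313DZ (𝔬 i) 1 (H₀ i) (geoOK_geo9K (π i)) (wZ i) (hwZ i) B₃ δ₃ (bH i) U ∧
          Letters313DMZ (𝔬 i) (𝔭 i) (Dd i) 1 (H₀ i) (geoOK_geo9K (π i)) (wZ i) (hwZ i) B₃ Bq δ₃ (bH i) U)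
    (hG0C : ∀ i : J, M₁ ≤ (geo9K (π i)).M → ∀ α₀ : ℝ, 0 < α₀ → (geo9K (π i)).M * α₀ ≤ a₁ →
      ∀ U : (bgT3 (π i)).Cfg, (bgT3 (π i)).Reg335 c35 α₀ U → (bgT3 (π i)).Reg336 c35 α₀ U →
        Thm33G0Dir (𝔬 i) (𝔭 i) (Dd i) (Dds i) 1 (H₀ i) (bHX i) B₀ Bh Bi Bi2 δ₀ U ∧
          Thm33G0DirR (𝔬 i) (Dds i) 1 (H₀ i) B₀ δ₀ U)
    (hstepD : ∀ i : J, M₁ ≤ (geo9K (π i)).M → ∀ α₀ : ℝ, 0 < α₀ → (geo9K (π i)).M * α₀ ≤ a₁ →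
      ∀ U : (bgT3 (π i)).Cfg, (bgT3 (π i)).Reg335 c35 α₀ U → (bgT3 (π i)).Reg336 c35 α₀ U →
        StepDirB (𝔬 i) (𝔭 i) (Dd i) (Dds i) 1 (H₀ i) (bHX i) (geoOK_geo9K (π i)).lenle (θD * ((geo9K (π i)).M * α₀))
          (fun β => θH β * ((geo9K (π i)).M * α₀)) (fun ε => θI ε * ((geo9K (π i)).M * α₀)) δK U)
    (hLHH : ∀ i : J, M₁ ≤ (geo9K (π i)).M → ∀ α₀ : ℝ, 0 < α₀ → (geo9K (π i)).M * α₀ ≤ a₁ →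
      ∀ U : (bgT3 (π i)).Cfg, (bgT3 (π i)).Reg335 c35 α₀ U → (bgT3 (π i)).Reg336 c35 α₀ U →
        LettersHHZ (𝔬 i) (𝔭 i) 1 (H₀ i) (geoOK_geo9K (π i)).lenle
          (weightNorm (BlockNorm.ofBlocks (toB6 (geo9K (π i)) 1 (H₀ i)) (𝔬 i).blkZ) (wZ i) fun y => (hwZ i y).le) Bq δ₃ U)
    (hLH3 : ∀ i : J, M₁ ≤ (geo9K (π i)).M → ∀ α₀ : ℝ, 0 < α₀ → (geo9K (π i)).M * α₀ ≤ a₁ →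
      ∀ U : (bgT3 (π i)).Cfg, (bgT3 (π i)).Reg335 c35 α₀ U → (bgT3 (π i)).Reg336 c35 α₀ U →
        Letters313HZc (𝔬 i) (𝔭 i) (Gp i) 1 (H₀ i) (geoOK_geo9K (π i)) (wZ i) (hwZ i) (bH i) BhD Bx δ₃ (bXH i) U)
    (hG0L2 : ∀ i : J, M₁ ≤ (geo9K (π i)).M → ∀ α₀ : ℝ, 0 < α₀ → (geo9K (π i)).M * α₀ ≤ a₁ →
      ∀ U : (bgT3 (π i)).Cfg, (bgT3 (π i)).Reg335 c35 α₀ U → (bgT3 (π i)).Reg336 c35 α₀ U →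
        Thm33G0L2M (𝔬 i) (Dd i) (Dds i) 1 (H₀ i) B₂ δ₀ U)
    (hstepL2 : ∀ i : J, M₁ ≤ (geo9K (π i)).M → ∀ α₀ : ℝ, 0 < α₀ → (geo9K (π i)).M * α₀ ≤ a₁ →
      ∀ U : (bgT3 (π i)).Cfg, (bgT3 (π i)).Reg335 c35 α₀ U → (bgT3 (π i)).Reg336 c35 α₀ U →
        StepL2 (𝔬 i) 1 (H₀ i) (θ₂ * ((geo9K (π i)).M * α₀)) δK U)
    (vZ : ∀ i : J, (geo9K (π i)).Site → ℝ) (hvZ : ∀ i y, 0 < vZ i y)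
    -- ======== RE-CUT: the block-L² record by its KEPT fields ========
    (hLL2 : ∀ i : J, M₁ ≤ (geo9K (π i)).M → ∀ α₀ : ℝ, 0 < α₀ → (geo9K (π i)).M * α₀ ≤ a₁ →
      ∀ U : (bgT3 (π i)).Cfg, (bgT3 (π i)).Reg335 c35 α₀ U → (bgT3 (π i)).Reg336 c35 α₀ U →
        Letters313L2Pk (𝔬 i) (Dd i) (Dds i) 1 (H₀ i) B₄ δ₃ (vZ i) (hvZ i) U ∧
          Letters313L2MZ (𝔬 i) (Dd i) (Dds i) 1 (H₀ i) B₄ δ₃ (vZ i) (hvZ i) U)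
    (hLIM : ∀ i : J, M₁ ≤ (geo9K (π i)).M → ∀ α₀ : ℝ, 0 < α₀ → (geo9K (π i)).M * α₀ ≤ a₁ →
      ∀ U : (bgT3 (π i)).Cfg, (bgT3 (π i)).Reg335 c35 α₀ U → (bgT3 (π i)).Reg336 c35 α₀ U →
        Letters313IMB (𝔬 i) (𝔭 i) (Dd i) (Dds i) 1 (H₀ i) (geoOK_geo9K (π i)).lenle (bHX i) (bHW i) Br (fun ε => θV ε * ((geo9K (π i)).M * α₀))
          Bd Bd2 δ₃ δK U)
    (HasRWExp : ∀ i : J, B9.KernelFamily (geo9K (π i)) (bgT3 (π i)) → (bgT3 (π i)).Cfg → ℝ → Prop)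
    (PosDefK : ∀ i : J, B9.KernelFamily (geo9K (π i)) (bgT3 (π i)) → (bgT3 (π i)).Cfg → Prop)
    (hpinE : ∀ i : J, HasRWExp i = HasRWExpOfOps (𝔬 i)) (hpinK : ∀ i : J, PosDefK i = PosDefKOfOps (𝔬 i)) :
    B9.Thm313Printed c35 (fun i : J => geo9K (π i)) (fun i : J => bgT3 (π i)) GG HasRWExp PosDefK := by
  classical
  -- the letters' rate is positive (ρ′ > 0, ρ′ + 3σ ≤ ρ ≤ δ₃) and strictly below the G′-material's rate δG: room for two (2.60) shifts and one margin
  have hδ₃pos : 0 < δ₃ := by linarith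
  have hδGpos : 0 < δG := hδ₃pos.trans hδ₃G
  obtain ⟨τ, hτdef⟩ : ∃ τ : ℝ, τ = (δG - δ₃) / 3 := ⟨_, rfl⟩
  have hτpos : 0 < τ := by rw [hτdef]; exact div_pos (by linarith) (by norm_num)
  have hτ3 : 3 * τ = δG - δ₃ := by rw [hτdef]; ring
  obtain ⟨αf, hαfdef⟩ : ∃ αf : ℝ, αf = τ / δG := ⟨_, rfl⟩
  have hαfpos : 0 < αf := by rw [hαfdef]; exact div_pos hτpos hδGpos
  have hαfδ : αf * δG = τ := by rw [hαfdef]; exact div_mul_cancel₀ τ hδGpos.ne'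
  have hαf2 : αf < 1 / 2 := by
    rw [hαfdef, div_lt_iff₀ hδGpos]
    linarith
  -- the member facts at (δG, αf) and the row sum at margin τ, above one M-threshold (no geometry hypotheses)
  obtain ⟨Mth, -, -, hfacts⟩ :=
    lemma21Pack_geo9K_fam π H₀ (αF := 1 / 2) hαfpos hαf2 hδGpos (by norm_num) (by norm_num)
  obtain ⟨ML, c, hrow⟩ := rowSum261_geo9K_fam π τ hτpos
  have hrow' : ∀ i : J, ML ≤ (geo9K (π i)).M → RowSum (toB6 (geo9K (π i)) 1 (H₀ i)) τ (max c 0) :=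
    fun i hM y => (hrow i hM y).trans (le_max_left _ _)
  have hc' : (0 : ℝ) ≤ max c 0 := le_max_right _ _
  -- the common constant of the re-assembled block-L² record and the common threshold
  obtain ⟨B₄s, hB₄sdef⟩ : ∃ B₄s : ℝ, B₄s = max B₄ (ϱ * ((ℓ + 1 : ℕ) : ℝ) * (BD + CP * ((ℓ + 1 : ℕ) : ℝ) * BG * max c 0)) := ⟨_, rfl⟩
  have hB₄le : B₄ ≤ B₄s := by rw [hB₄sdef]; exact le_max_left _ _
  have hBder : ϱ * ((ℓ + 1 : ℕ) : ℝ) * (BD + CP * ((ℓ + 1 : ℕ) : ℝ) * BG * max c 0) ≤ B₄s := by rw [hB₄sdef]; exact le_max_right _ _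
  have hB₄s0 : 0 ≤ B₄s := hB₄.trans hB₄le
  obtain ⟨M₁s, hM₁sdef⟩ : ∃ M₁s : ℝ, M₁s = max M₁ (max Mth ML) := ⟨_, rfl⟩
  have hM₁le : M₁ ≤ M₁s := by rw [hM₁sdef]; exact le_max_left _ _
  have hMth : Mth ≤ M₁s := by rw [hM₁sdef]; exact (le_max_left _ _).trans (le_max_right _ _)
  have hML : ML ≤ M₁s := by rw [hM₁sdef]; exact (le_max_right _ _).trans (le_max_right _ _)
  have hM₁s : 0 < M₁s := lt_of_lt_of_le hM₁ hM₁le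
  -- the budget rows of `vDRDG_of_ids3152 ∕ vGDRD_of_ids3152` at (δ, α, σ) := (δG, αf, τ): δG − τ − αf·δG = δ₃ + τ, δG − τ − 2αf·δG = δ₃
  have hαδ : 0 ≤ αf * δG := by rw [hαfδ]; exact hτpos.le
  have hbud : 0 ≤ δG - τ - αf * δG := by rw [hαfδ]; linarith
  have hδD : δG - τ - αf * δG ≤ δG := by rw [hαfδ]; linarith
  have hδ₄ : δ₃ ≤ δG - τ - 2 * (αf * δG) := by rw [hαfδ]; linarith
  -- the cut block-L² record RE-ASSEMBLED above the threshold: kept fields raised to `B₄s`, the two letters DERIVED at (B₄s, δ₃)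
  have hLL2c : ∀ i : J, M₁s ≤ (geo9K (π i)).M → ∀ α₀ : ℝ, 0 < α₀ → (geo9K (π i)).M * α₀ ≤ a₁ →
      ∀ U : (bgT3 (π i)).Cfg, (bgT3 (π i)).Reg335 c35 α₀ U → (bgT3 (π i)).Reg336 c35 α₀ U →
        Letters313L2Pc (𝔬 i) (Dd i) (Dds i) 1 (H₀ i) B₄s δ₃ (vZ i) (hvZ i) U ∧
          Letters313L2MZ (𝔬 i) (Dd i) (Dds i) 1 (H₀ i) B₄s δ₃ (vZ i) (hvZ i) U := by
    intro i hM α₀ hα₀ hMa U hU hU'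
    have hMi : M₁ ≤ (geo9K (π i)).M := hM₁le.trans hM
    obtain ⟨hk, hm⟩ := hLL2 i hMi α₀ hα₀ hMa U hU hU'
    obtain ⟨hGpT, hDvT, hPT⟩ := hT i hMi α₀ hα₀ hMa U hU hU'
    have hF := hfacts i (hMth.trans hM)
    have hR := hrow' i (hML.trans hM)
    refine ⟨B9Thm313WholeLettersCutKept.Letters313L2Pc.of_kept (hk.mono (geoOK_geo9K (π i)) hB₄ hB₄le le_rfl) ?_ ?_, letters313L2MZ_mono_const (geoOK_geo9K (π i)) hB₄le hm⟩
    · exact vDRDG_of_ids3152 (geoOK_geo9K (π i)) hF hR (h31 i hMi α₀ hα₀ hMa U hU hU') (h49 i hMi α₀ hα₀ hMa U hU hU')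
        (hDGD i hMi α₀ hα₀ hMa U hU hU') (hRP i hMi α₀ hα₀ hMa U hU hU') (h152 i hMi α₀ hα₀ hMa U hU hU') hGpT hDvT hPT
        hϱ hBG hCP hBD hc' hτpos.le hαδ le_rfl le_rfl hbud hδD hBder hδ₄
    · exact vGDRD_of_ids3152 (geoOK_geo9K (π i)) hF hR (h31 i hMi α₀ hα₀ hMa U hU hU') (h49 i hMi α₀ hα₀ hMa U hU hU')
        (hDGD i hMi α₀ hα₀ hMa U hU hU') (hRP i hMi α₀ hα₀ hMa U hU hU') (h152 i hMi α₀ hα₀ hMa U hU hU') hGpT hDvT hPT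
        hϱ hBG hCP hBD hc' hτpos.le hαδ le_rfl le_rfl hbud hδD hBder hδ₄
  -- the parent leaf BY NAME at (B₄s, M₁s); every displayed row above M₁ restricts to M₁s
  exact t313_of_pins_completePairMBZc_fam π 𝔬 H₀ GG bH 𝔭 bHX Gp bXH Dd Dds bHW ev evY
    r Cev θ₁ θD θ₂ r₁ B₀ B₂ B₄s δ₀ δK σ ρ a₁ M₁s B₃ δ₃ ρ' α κ₀ Bh Bi Bq BhD Bx Bd θH θI θV Br Bi2 Bd2
    hθ₁ hθD hθH hθI hθ₂ hθV hr₁ hB₀ hB₂ hB₃ hB₄s0 hBr hσ hρ' hρ'ρ hρ'ρ₅ hσρ' hρS hρ₃ hρδ ha₁ hM₁s hα0 hα1 hBi hBd hBi2 hBd2 hBh hBq hBhD hBx hCev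
    hκ hκW hκX hcoR hco1R hcoG (fun i hM => hsymGG i (hM₁le.trans hM)) hl2N hH1N hIF
    (fun i hM => hmodel i (hM₁le.trans hM)) (fun i hM => hleft i (hM₁le.trans hM)) wZ hwZ
    (fun i hM => hletters i (hM₁le.trans hM)) (fun i hM => h152 i (hM₁le.trans hM)) (fun i hM => hlettersD i (hM₁le.trans hM))
    (fun i hM => hG0C i (hM₁le.trans hM)) (fun i hM => hstepD i (hM₁le.trans hM)) (fun i hM => hLHH i (hM₁le.trans hM))
    (fun i hM => hLH3 i (hM₁le.trans hM)) (fun i hM => hG0L2 i (hM₁le.trans hM)) (fun i hM => hstepL2 i (hM₁le.trans hM)) vZ hvZ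
    hLL2c (fun i hM => hLIM i (hM₁le.trans hM)) HasRWExp PosDefK hpinE hpinK

end Summit.QuantumFields.YangMills.Theorems.Prop7SectET3N06LeavesRecordCutKeptFam

end
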